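import Summits.QuantumFields.BalabanUV.Beta.GAN24.VolumeLimitPairsFibre

/-!
# `BalabanUV.Beta.GAN24.VolumeLimitPairsRect` — binder row G-an2-4 ∕ (CONV-C), routes C-R6° («VALUES») × R7 («TWO CURRENCIES»), PART 185:
# THE EL₂ KIT FOR RECTANGULAR FACTORS AND REAL SYMMETRIC FORMS.  PART 144 (`VolumeLimitPairsFibre`) gives pair products and inverses on `Site d (side t) × F` for ONE finite
# fibre `F` and complex matrices; the gauge-fixed one-loop letter `𝒢_n = flucCov(re Δ_n, Q_ax)` (PARTs 180–184) is REAL, and its formula `K⁻¹ − (K⁻¹Q_axᵀ)P⁻¹(Q_axK⁻¹)` mixes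
# two carriers (fine bonds; the stacked coarse index (coarse bonds) ⊕ T) which, read over the coarse torus, are `Site × F` with DIFFERENT fibres.  This file supplies the generic pieces
# the volume limit of `𝒢_n` needs and nothing model-specific: (1) pair products with THREE fibres `F, G, H` (rectangular factors), (2) the exact-window lemma `ẑ_s = 0 ↔ z = 0` for
# `|z_i| < s` (eventual constancy of local stencils), (3) real ↔ complex: `(B ⊗ ℂ)⁻¹ = B⁻¹ ⊗ ℂ`, the complex form of `B ⊗ ℂ`, and PART 138's Neumann ratio `‖1 − Λ⁻¹(B ⊗ ℂ)‖ ≤ 1 − γ∕Λ`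
# for a REAL SYMMETRIC `B` with `γ|u|² ≤ ⟨u,Bu⟩ ≤ Λ|u|²`, (4) quadratic forms and symmetry under a bijective re-indexing (the presentation maps of PART 186 are bare bijections),
# (5) the torus sup-distance `tdist` against the window norm on `Site d s` at a PAIR (`e^{−m·tdist(y,y′)} ≤ e^{−(m∕d)|windowMap(y − y′)|₁}`) (unit b2b-balaban-gan24-p3, gen 61; v1)

NOT IN PRINT; OUR PROOF ([folklore] bookkeeping BY NAME over PART 142 `DiagramVolumeLimitPairs.tendsto_sum_window` ∕ `l1_windowMap_sub_castT_ge` ∕ `l1_windowMap_neg` ∕ `tdist_eq_tdist_sub_zero`,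
PART 138 `VolumeLimitCovariance.opNorm_one_sub_smul_le` ∕ `re_star_dotProduct_self`, PART 134 `DiagramDecayWindow.l1_windowMap_le`, NE2's `VariationalOpNorm.opNorm_le_of_quadForm`,
`B12Sec2to5.summable_exp_neg_l1`, Mathlib's `Matrix.submatrix_mulVec_equiv` ∕ `Matrix.inv_eq_left_inv` ∕ `Matrix.map_mul`; [Balaban1987RG1] p. 264 (after (1.21)) LOCATES the
`T ↗ ℤ^d` limit; nothing printed is a hypothesis).
HONEST FRAMING (cell contract, verbatim): «discharging `BetaPertH` makes Bałaban's UV stability UNCONDITIONAL — a real constructive-QFT result; it is NOT the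
continuum limit and NOT the Clay problem.»  HONEST DEPENDENCY (verbatim): «continuum YM on T⁴ ⇐ BetaPertH ∧ nine spine estimates (0/9 proved); BetaPertH ⇐
(D1) ∧ (D4) ∧ CAP+tail; G-an2-4 gates asym, D1 and NE2/3/4.»

WHAT THIS FILE PROVES (0 sorry, 0 `def`; `ẑ_t = castT (cubic d (side t)) z`; EL₂(X_t) ≡ `∀ readings, ∃ s, X_t((ẑ,f),(ẑ′,h)) → s` along `side t → ∞`):
* §1 **`tendsto_mul_pair₃`** ∕ **`tendsto_mul_pair₃'`** — EL₂ OF RECTANGULAR PRODUCTS `X_t·Y_t`, `X_t : (Site × F) × (Site × G)`, `Y_t : (Site × G) × (Site × H)`: one factor volume-uniformly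
  bounded, the other with volume-uniform window decay (from the right site ∕ from the left site), both EL₂ ⟹ EL₂ of the product (PART 144 §1 verbatim with three fibres).
* §2 `intCast_zmod_eq_zero_iff_of_abs_lt` (`(z : ZMod s) = 0 ↔ z = 0` for `|z| < s`), **`castT_eq_zero_iff_of_abs_lt`**, **`castT_eq_castT_iff_of_abs_lt`**,
  `eventually_castT_eq_castT_iff` (along `side t → ∞`, for `c ≥ 1`: eventually `castT (cubic d (c·side t)) z = castT … z′ ↔ z = z′`).
* §3 `map_ofReal_inv` (`(B ⊗ ℂ)⁻¹ = B⁻¹ ⊗ ℂ` for `det B ≠ 0`), `isHermitian_map_ofReal`, `re_form_map_ofReal` (`Re⟨v,(B ⊗ ℂ)v⟩ = ⟨v_re,Bv_re⟩ + ⟨v_im,Bv_im⟩`), `nsq_eq_dotProduct_add`,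
  `coercive_map_ofReal`, `opNorm_map_ofReal_le`, **`opNorm_one_sub_smul_map_ofReal_le`** (`γ|u|² ≤ ⟨u,Bu⟩ ≤ Λ|u|²`, `Bᵀ = B`, `0 < γ ≤ Λ` ⟹ `‖1 − Λ⁻¹•(B ⊗ ℂ)‖ ≤ 1 − γ∕Λ`).
* §4 `dotProduct_comp_of_bijective`, `submatrix_mulVec_of_bijective`, **`form_submatrix_eq`** (`⟨v,(S∘(e,e))v⟩ = ⟨v∘e⁻¹, S(v∘e⁻¹)⟩`), **`coercive_submatrix`**, **`form_le_submatrix`**,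
  `transpose_submatrix_eq` (symmetry), **`inv_submatrix_of_bijective`** (`(S∘(e,e))⁻¹ = S⁻¹∘(e,e)`).
* §5 **`exp_neg_tdist_le_exp_window`** (`e^{−m·tdist(y,y′)} ≤ e^{−(m∕d)|windowMap(y − y′)|₁}` on `Site d s`, `m ≥ 0`, `d ≥ 1`), `exp_neg_tdist_le_exp_window'` (the `y′ − y` form).
WHAT IT DOES NOT DO: nothing about Bałaban's operators; the presentation maps and the model letters are PARTs 186 ff.  SUPPLIER work; NEVER «G-an2-4 closed»; NOT (CONV-C), NOT D1,
NOT `BetaPertH`, NOT continuum, NOT Clay.  Records: `HOME/b2b-balaban-gan24-p3/gen61/README.md`.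
-/

noncomputable section

open scoped BigOperators ComplexConjugate Matrix Matrix.Norms.L2Operator
open Filter Topology

namespace Summit.QuantumFields.BalabanUV.Beta.GAN24.VolumeLimitPairsRect

open Literature.MathematicalPhysics.QuantumFieldTheory.Balaban1983to89
open Literature.MathematicalPhysics.QuantumFieldTheory.Balaban1983to89.B12Sec2to5 (l1 summable_exp_neg_l1)
open Literature.MathematicalPhysics.QuantumFieldTheory.Balaban1983to89.B5Prop11Lower (nsq nsq_nonneg)
open Literature.MathematicalPhysics.QuantumFieldTheory.Balaban1983to89.Beta (Site symmRep windowMap)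
open Literature.MathematicalPhysics.QuantumFieldTheory.Balaban1983to89.Beta.FreeLegDictionary (cubic)
open Literature.MathematicalPhysics.QuantumFieldTheory.Balaban1983to89.Beta.VectorTails (castT castT_add castT_neg)
open Literature.MathematicalPhysics.QuantumFieldTheory.Balaban1983to89.Beta.VectorPropagatorLimit (castT_sub)
open Literature.MathematicalPhysics.QuantumFieldTheory.Balaban1983to89.Beta.VectorTailsCov (tdist tdist_comm)
open Summit.QuantumFields.BalabanUV.T4Continuum.CoerciveInverseTower (Coercive)
open Summit.QuantumFields.BalabanUV.T4Continuum.VariationalOpNorm (opNorm_le_of_quadForm)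
open Summit.QuantumFields.BalabanUV.Beta.GAN24.DiagramVolumeLimitPairs (tendsto_sum_window l1_windowMap_sub_castT_ge l1_windowMap_neg tdist_eq_tdist_sub_zero)
open Summit.QuantumFields.BalabanUV.Beta.GAN24.DiagramDecayWindow (l1_windowMap_le)
open Summit.QuantumFields.BalabanUV.Beta.GAN24.VolumeLimitCovariance (opNorm_one_sub_smul_le re_star_dotProduct_self)

variable {d : ℕ}

/-! ## §1 Pair products with three fibres -/

section Products

variable {F G H : Type*} [Fintype F] [Fintype G] [Fintype H] {side : ℕ → ℕ} [∀ t, NeZero (side t)]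

omit [Fintype F] [Fintype H] in
/-- **`tendsto_mul_pair₃` — EL₂ OF RECTANGULAR PRODUCTS, RIGHT FACTOR DECAYING** [folklore]: along `side t → ∞`, `X_t : (Site × F) × (Site × G)` with `‖X_t((x,f),(w,g))‖ ≤ B`,
`Y_t : (Site × G) × (Site × H)` with `‖Y_t((w,g),(y,h))‖ ≤ C·e^{−δ|windowMap(w − y)|₁}` (`δ > 0`, `B, C ≥ 0`), EL₂ of both ⟹ EL₂ of `X_t·Y_t` (PART 142's Tannery over the window, one
window sum per middle fibre index `g`, majorant `B·C·e^{3δ|z′|₁}·e^{−δ|y|₁}` — PART 144 `tendsto_mul_pair` verbatim with three fibres). -/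
theorem tendsto_mul_pair₃ (hside : Tendsto side atTop atTop) {X : (t : ℕ) → Matrix (Site d (side t) × F) (Site d (side t) × G) ℂ}
    {Y : (t : ℕ) → Matrix (Site d (side t) × G) (Site d (side t) × H) ℂ} {B C δ : ℝ} (hB0 : 0 ≤ B) (hC0 : 0 ≤ C)
    (hB : ∀ t (x : Site d (side t)) (f : F) (w : Site d (side t)) (g : G), ‖X t (x, f) (w, g)‖ ≤ B)
    (hdec : ∀ t (w : Site d (side t)) (g : G) (y : Site d (side t)) (h : H), ‖Y t (w, g) (y, h)‖ ≤ C * Real.exp (-δ * l1 (windowMap d (side t) (w - y)))) (hδ : 0 < δ)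
    (hX : ∀ (f : F) (g : G) (z z' : Fin d → ℤ), ∃ s : ℂ, Tendsto (fun t => X t (castT (cubic d (side t)) z, f) (castT (cubic d (side t)) z', g)) atTop (𝓝 s))
    (hY : ∀ (g : G) (h : H) (z z' : Fin d → ℤ), ∃ s : ℂ, Tendsto (fun t => Y t (castT (cubic d (side t)) z, g) (castT (cubic d (side t)) z', h)) atTop (𝓝 s))
    (f : F) (h : H) (z z' : Fin d → ℤ) :
    ∃ s : ℂ, Tendsto (fun t => (X t * Y t) (castT (cubic d (side t)) z, f) (castT (cubic d (side t)) z', h)) atTop (𝓝 s) := by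
  classical
  choose P hP using hX
  choose Q hQ using hY
  refine ⟨∑ g, ∑' y, P f g z y * Q g h y z', ?_⟩
  have e : ∀ t, (X t * Y t) (castT (cubic d (side t)) z, f) (castT (cubic d (side t)) z', h)
      = ∑ g : G, ∑ w : Site d (side t), X t (castT (cubic d (side t)) z, f) (w, g) * Y t (w, g) (castT (cubic d (side t)) z', h) := by
    intro t; rw [Matrix.mul_apply, Fintype.sum_prod_type, Finset.sum_comm]
  simp only [e]
  refine tendsto_finsetSum _ fun g _ => ?_
  refine tendsto_sum_window hside (F := fun t w => X t (castT (cubic d (side t)) z, f) (w, g) * Y t (w, g) (castT (cubic d (side t)) z', h))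
    (fun y => (hP f g z y).mul (hQ g h y z')) (((summable_exp_neg_l1 hδ d).mul_left (B * C * Real.exp (δ * (3 * l1 z')))))
    (fun y => by positivity) fun t w => ?_
  rw [norm_mul]
  have h1 := hB t (castT (cubic d (side t)) z) f w g
  have h2 := hdec t w g (castT (cubic d (side t)) z') h
  have h3 := l1_windowMap_sub_castT_ge (side t) w z'
  have h4 : Real.exp (-δ * l1 (windowMap d (side t) (w - castT (cubic d (side t)) z'))) ≤ Real.exp (δ * (3 * l1 z')) * Real.exp (-δ * l1 (windowMap d (side t) w)) := by
    rw [← Real.exp_add]; exact Real.exp_le_exp.mpr (by nlinarith)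
  calc ‖X t _ _‖ * ‖Y t _ _‖ ≤ B * (C * Real.exp (-δ * l1 (windowMap d (side t) (w - castT (cubic d (side t)) z')))) := mul_le_mul h1 h2 (norm_nonneg _) hB0
    _ ≤ B * (C * (Real.exp (δ * (3 * l1 z')) * Real.exp (-δ * l1 (windowMap d (side t) w)))) := by gcongr
    _ = B * C * Real.exp (δ * (3 * l1 z')) * Real.exp (-δ * l1 (windowMap d (side t) w)) := by ring

omit [Fintype F] [Fintype H] in
/-- **`tendsto_mul_pair₃'` — EL₂ OF RECTANGULAR PRODUCTS, LEFT FACTOR DECAYING** [folklore]: `‖X_t((x,f),(w,g))‖ ≤ C·e^{−δ|windowMap(w − x)|₁}`, `‖Y_t((w,g),(y,h))‖ ≤ B`. -/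
theorem tendsto_mul_pair₃' (hside : Tendsto side atTop atTop) {X : (t : ℕ) → Matrix (Site d (side t) × F) (Site d (side t) × G) ℂ}
    {Y : (t : ℕ) → Matrix (Site d (side t) × G) (Site d (side t) × H) ℂ} {B C δ : ℝ} (hB0 : 0 ≤ B) (hC0 : 0 ≤ C)
    (hdec : ∀ t (x : Site d (side t)) (f : F) (w : Site d (side t)) (g : G), ‖X t (x, f) (w, g)‖ ≤ C * Real.exp (-δ * l1 (windowMap d (side t) (w - x)))) (hδ : 0 < δ)
    (hB : ∀ t (w : Site d (side t)) (g : G) (y : Site d (side t)) (h : H), ‖Y t (w, g) (y, h)‖ ≤ B)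
    (hX : ∀ (f : F) (g : G) (z z' : Fin d → ℤ), ∃ s : ℂ, Tendsto (fun t => X t (castT (cubic d (side t)) z, f) (castT (cubic d (side t)) z', g)) atTop (𝓝 s))
    (hY : ∀ (g : G) (h : H) (z z' : Fin d → ℤ), ∃ s : ℂ, Tendsto (fun t => Y t (castT (cubic d (side t)) z, g) (castT (cubic d (side t)) z', h)) atTop (𝓝 s))
    (f : F) (h : H) (z z' : Fin d → ℤ) :
    ∃ s : ℂ, Tendsto (fun t => (X t * Y t) (castT (cubic d (side t)) z, f) (castT (cubic d (side t)) z', h)) atTop (𝓝 s) := by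
  classical
  choose P hP using hX
  choose Q hQ using hY
  refine ⟨∑ g, ∑' y, P f g z y * Q g h y z', ?_⟩
  have e : ∀ t, (X t * Y t) (castT (cubic d (side t)) z, f) (castT (cubic d (side t)) z', h)
      = ∑ g : G, ∑ w : Site d (side t), X t (castT (cubic d (side t)) z, f) (w, g) * Y t (w, g) (castT (cubic d (side t)) z', h) := by
    intro t; rw [Matrix.mul_apply, Fintype.sum_prod_type, Finset.sum_comm]
  simp only [e]
  refine tendsto_finsetSum _ fun g _ => ?_
  refine tendsto_sum_window hside (F := fun t w => X t (castT (cubic d (side t)) z, f) (w, g) * Y t (w, g) (castT (cubic d (side t)) z', h))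
    (fun y => (hP f g z y).mul (hQ g h y z')) (((summable_exp_neg_l1 hδ d).mul_left (C * B * Real.exp (δ * (3 * l1 z)))))
    (fun y => by positivity) fun t w => ?_
  rw [norm_mul]
  have h1 := hdec t (castT (cubic d (side t)) z) f w g
  have h2 := hB t w g (castT (cubic d (side t)) z') h
  have h3 := l1_windowMap_sub_castT_ge (side t) w z
  have h4 : Real.exp (-δ * l1 (windowMap d (side t) (w - castT (cubic d (side t)) z))) ≤ Real.exp (δ * (3 * l1 z)) * Real.exp (-δ * l1 (windowMap d (side t) w)) := by
    rw [← Real.exp_add]; exact Real.exp_le_exp.mpr (by nlinarith)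
  calc ‖X t _ _‖ * ‖Y t _ _‖ ≤ (C * Real.exp (-δ * l1 (windowMap d (side t) (w - castT (cubic d (side t)) z)))) * B := mul_le_mul h1 h2 (norm_nonneg _) (by positivity)
    _ ≤ (C * (Real.exp (δ * (3 * l1 z)) * Real.exp (-δ * l1 (windowMap d (side t) w)))) * B := by gcongr
    _ = C * B * Real.exp (δ * (3 * l1 z)) * Real.exp (-δ * l1 (windowMap d (side t) w)) := by ring

end Products

/-! ## §2 The exact window: `ẑ = 0 ↔ z = 0` for `|z_i| < s` -/

section ExactWindow

/-- `(z : ZMod s) = 0 ↔ z = 0` for `|z| < s`. [folklore] -/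
theorem intCast_zmod_eq_zero_iff_of_abs_lt {s : ℕ} {z : ℤ} (hz : |z| < s) : ((z : ZMod s)) = 0 ↔ z = 0 := by
  rw [ZMod.intCast_zmod_eq_zero_iff_dvd]
  constructor
  · intro h
    rcases h with ⟨m, hm⟩
    rcases eq_or_ne m 0 with rfl | hm0
    · simpa using hm
    · exfalso
      have h1 : (s : ℤ) ≤ |z| := by
        rw [hm, abs_mul, abs_of_nonneg (Nat.cast_nonneg s)]
        have : (1 : ℤ) ≤ |m| := Int.one_le_abs hm0
        nlinarith [Nat.cast_nonneg (α := ℤ) s]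
      exact absurd hz (not_lt.mpr h1)
  · rintro rfl; simp

/-- **`castT_eq_zero_iff_of_abs_lt`**: on the cubic torus `(ℤ∕s)^d`, `castT z = 0 ↔ z = 0` as soon as `|z_i| < s` for all `i`. [folklore] -/
theorem castT_eq_zero_iff_of_abs_lt {s : ℕ} {z : Fin d → ℤ} (hz : ∀ i, |z i| < s) : castT (cubic d s) z = 0 ↔ z = 0 := by
  constructor
  · intro h
    funext i
    have hi := congrFun h i
    simp only [castT, Pi.zero_apply] at hi
    exact (intCast_zmod_eq_zero_iff_of_abs_lt (hz i)).mp hi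
  · rintro rfl
    funext i
    simp [castT]

/-- **`castT_eq_castT_iff_of_abs_lt`**: `castT z = castT z′ ↔ z = z′` on `(ℤ∕s)^d` as soon as `|z_i − z′_i| < s` for all `i`. [folklore] -/
theorem castT_eq_castT_iff_of_abs_lt {s : ℕ} {z z' : Fin d → ℤ} (hz : ∀ i, |z i - z' i| < s) : castT (cubic d s) z = castT (cubic d s) z' ↔ z = z' := by
  rw [← sub_eq_zero, ← castT_sub, castT_eq_zero_iff_of_abs_lt (fun i => by simpa using hz i), sub_eq_zero]

variable {side : ℕ → ℕ}

/-- **`eventually_castT_eq_castT_iff`** — along `side t → ∞` and for any `c ≥ 1`, EVENTUALLY `castT (cubic d (c·side t)) z = castT … z′ ↔ z = z′` (fixed integer readings separate on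
large tori; the finer torus `c·side t` separates whatever the coarse one does). [folklore] -/
theorem eventually_castT_eq_castT_iff (hside : Tendsto side atTop atTop) (c : ℕ) (hc : 1 ≤ c) (z z' : Fin d → ℤ) :
    ∀ᶠ t in atTop, (castT (cubic d (c * side t)) z = castT (cubic d (c * side t)) z' ↔ z = z') := by
  filter_upwards [hside.eventually_gt_atTop (Finset.univ.sup fun i => (z i - z' i).natAbs)] with t ht
  refine castT_eq_castT_iff_of_abs_lt fun i => ?_
  have h1 : (z i - z' i).natAbs ≤ Finset.univ.sup fun i => (z i - z' i).natAbs := Finset.le_sup (f := fun i => (z i - z' i).natAbs) (Finset.mem_univ i)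
  have h2 : (z i - z' i).natAbs < c * side t := lt_of_lt_of_le (lt_of_le_of_lt h1 ht) (Nat.le_mul_of_pos_left _ (by omega))
  have h3 : |z i - z' i| = ((z i - z' i).natAbs : ℤ) := (Int.natCast_natAbs _).symm
  rw [h3]; exact_mod_cast h2

end ExactWindow

/-! ## §3 Real versus complex -/

section RealComplex

variable {ι : Type*} [Fintype ι] [DecidableEq ι]

/-- `(B ⊗ ℂ)⁻¹ = B⁻¹ ⊗ ℂ` for a real matrix with `det B ≠ 0`. [folklore] -/
theorem map_ofReal_inv {B : Matrix ι ι ℝ} (hB : IsUnit B.det) : (B.map ((↑) : ℝ → ℂ))⁻¹ = B⁻¹.map ((↑) : ℝ → ℂ) := by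
  apply Matrix.inv_eq_left_inv
  rw [show ((↑) : ℝ → ℂ) = (Complex.ofRealHom : ℝ → ℂ) from rfl, ← Matrix.map_mul, Matrix.nonsing_inv_mul _ hB,
    Matrix.map_one _ (map_zero _) (map_one _)]

omit [Fintype ι] [DecidableEq ι] in
/-- the complexification of a real symmetric matrix is Hermitian. [folklore] -/
theorem isHermitian_map_ofReal {B : Matrix ι ι ℝ} (hB : Bᵀ = B) : (B.map ((↑) : ℝ → ℂ)).IsHermitian := by
  ext i j
  have h : B j i = B i j := by rw [← Matrix.transpose_apply B i j, hB]
  rw [Matrix.conjTranspose_apply, Matrix.map_apply, Matrix.map_apply, h, Complex.star_def, Complex.conj_ofReal]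

omit [DecidableEq ι] in
/-- `Re⟨v, (B ⊗ ℂ)v⟩ = ⟨v_re, Bv_re⟩ + ⟨v_im, Bv_im⟩` for a real matrix `B` (term by term). [folklore] -/
theorem re_form_map_ofReal (B : Matrix ι ι ℝ) (v : ι → ℂ) :
    (star v ⬝ᵥ ((B.map ((↑) : ℝ → ℂ)) *ᵥ v)).re
      = (fun i => (v i).re) ⬝ᵥ (B *ᵥ fun i => (v i).re) + (fun i => (v i).im) ⬝ᵥ (B *ᵥ fun i => (v i).im) := by
  simp only [dotProduct, Matrix.mulVec, Matrix.map_apply, Complex.re_sum, Finset.mul_sum, ← Finset.sum_add_distrib]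
  refine Finset.sum_congr rfl fun i _ => Finset.sum_congr rfl fun j _ => ?_
  simp only [Pi.star_apply, Complex.star_def, Complex.mul_re, Complex.conj_re, Complex.conj_im, Complex.ofReal_re, Complex.ofReal_im, zero_mul,
    sub_zero, Complex.mul_im, add_zero]
  ring

omit [DecidableEq ι] in
/-- `Σ|v_i|² = ⟨v_re, v_re⟩ + ⟨v_im, v_im⟩`. [folklore] -/
theorem nsq_eq_dotProduct_add (v : ι → ℂ) :
    nsq v = (fun i => (v i).re) ⬝ᵥ (fun i => (v i).re) + (fun i => (v i).im) ⬝ᵥ (fun i => (v i).im) := by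
  rw [← re_star_dotProduct_self]
  simp only [dotProduct, Pi.star_apply, Complex.re_sum, ← Finset.sum_add_distrib]
  refine Finset.sum_congr rfl fun i _ => ?_
  simp only [Complex.star_def, Complex.mul_re, Complex.conj_re, Complex.conj_im]
  ring

omit [DecidableEq ι] in
/-- **real coercivity ⟹ complex coercivity of the complexification**: `γ|u|² ≤ ⟨u,Bu⟩` for all real `u` ⟹ `Coercive γ (B ⊗ ℂ)`. [folklore] -/
theorem coercive_map_ofReal {B : Matrix ι ι ℝ} {γ : ℝ} (hlo : ∀ u : ι → ℝ, γ * (u ⬝ᵥ u) ≤ u ⬝ᵥ (B *ᵥ u)) : Coercive γ (B.map ((↑) : ℝ → ℂ)) := by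
  intro v
  rw [re_form_map_ofReal, nsq_eq_dotProduct_add, mul_add]
  exact add_le_add (hlo _) (hlo _)

/-- **the operator norm of the complexification from the real form**: `Bᵀ = B`, `0 ≤ ⟨u,Bu⟩ ≤ Λ|u|²` (`Λ ≥ 0`) ⟹ `‖B ⊗ ℂ‖ ≤ Λ`. [folklore] -/
theorem opNorm_map_ofReal_le {B : Matrix ι ι ℝ} (hB : Bᵀ = B) {Λ : ℝ} (hΛ : 0 ≤ Λ) (hpsd : ∀ u : ι → ℝ, 0 ≤ u ⬝ᵥ (B *ᵥ u))
    (hhi : ∀ u : ι → ℝ, u ⬝ᵥ (B *ᵥ u) ≤ Λ * (u ⬝ᵥ u)) : ‖B.map ((↑) : ℝ → ℂ)‖ ≤ Λ := by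
  refine opNorm_le_of_quadForm (isHermitian_map_ofReal hB) hΛ fun v => ?_
  rw [show ∑ i, ‖v i‖ ^ 2 = nsq v from rfl, re_form_map_ofReal, nsq_eq_dotProduct_add, mul_add]
  rw [abs_of_nonneg (add_nonneg (hpsd _) (hpsd _))]
  exact add_le_add (hhi _) (hhi _)

/-- **`opNorm_one_sub_smul_map_ofReal_le` — THE NEUMANN RATIO OF A REAL SYMMETRIC FORM**: `Bᵀ = B`, `γ|u|² ≤ ⟨u,Bu⟩ ≤ Λ|u|²` for all real `u`, `0 < γ ≤ Λ` ⟹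
`‖1 − Λ⁻¹•(B ⊗ ℂ)‖ ≤ 1 − γ∕Λ` (PART 138 `opNorm_one_sub_smul_le` for the complexification). [folklore] -/
theorem opNorm_one_sub_smul_map_ofReal_le {B : Matrix ι ι ℝ} (hB : Bᵀ = B) {γ Λ : ℝ} (hγ : 0 < γ) (hγΛ : γ ≤ Λ)
    (hlo : ∀ u : ι → ℝ, γ * (u ⬝ᵥ u) ≤ u ⬝ᵥ (B *ᵥ u)) (hhi : ∀ u : ι → ℝ, u ⬝ᵥ (B *ᵥ u) ≤ Λ * (u ⬝ᵥ u)) :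
    ‖(1 : Matrix ι ι ℂ) - ((Λ⁻¹ : ℝ) : ℂ) • B.map ((↑) : ℝ → ℂ)‖ ≤ 1 - γ / Λ := by
  have hpsd : ∀ u : ι → ℝ, 0 ≤ u ⬝ᵥ (B *ᵥ u) := fun u =>
    le_trans (mul_nonneg hγ.le (by simpa using dotProduct_self_star_nonneg u)) (hlo u)
  exact opNorm_one_sub_smul_le (isHermitian_map_ofReal hB) hγ hγΛ (coercive_map_ofReal hlo) (opNorm_map_ofReal_le hB (hγ.le.trans hγΛ) hpsd hhi)

end RealComplex

/-! ## §4 Quadratic forms and inverses under a bijective re-indexing -/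

section Reindex

variable {m n : Type*} [Fintype m] [Fintype n] [DecidableEq m] [DecidableEq n]

omit [Fintype m] [DecidableEq m] [DecidableEq n] in
/-- `Σ_a v(a)·w(e a) = Σ_b v(e⁻¹ b)·w(b)` for a bijection `e`. [folklore] -/
theorem dotProduct_comp_of_bijective {e : m → n} (he : Function.Bijective e) (v : m → ℝ) (w : n → ℝ) [Fintype m] :
    v ⬝ᵥ (w ∘ e) = (v ∘ (Equiv.ofBijective e he).symm) ⬝ᵥ w := by
  rw [dotProduct, dotProduct]
  rw [← (Equiv.ofBijective e he).sum_comp (fun b => (v ∘ (Equiv.ofBijective e he).symm) b * w b)]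
  refine Finset.sum_congr rfl fun a _ => ?_
  simp only [Function.comp_apply, Equiv.ofBijective_apply, Equiv.ofBijective_symm_apply_apply]

omit [DecidableEq m] [DecidableEq n] in
/-- `(S∘(e,e))·v = (S·(v∘e⁻¹))∘e` for a bijection `e` (`Matrix.submatrix_mulVec_equiv`). [folklore] -/
theorem submatrix_mulVec_of_bijective {e : m → n} (he : Function.Bijective e) (S : Matrix n n ℝ) (v : m → ℝ) :
    S.submatrix e e *ᵥ v = (S *ᵥ (v ∘ (Equiv.ofBijective e he).symm)) ∘ e := by
  have h := Matrix.submatrix_mulVec_equiv S v e (Equiv.ofBijective e he)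
  exact h

omit [DecidableEq m] [DecidableEq n] in
/-- **`form_submatrix_eq`** — the quadratic form of a re-indexed matrix: `⟨v, (S∘(e,e))v⟩ = ⟨v∘e⁻¹, S(v∘e⁻¹)⟩`. [folklore] -/
theorem form_submatrix_eq {e : m → n} (he : Function.Bijective e) (S : Matrix n n ℝ) (v : m → ℝ) :
    v ⬝ᵥ (S.submatrix e e *ᵥ v) = (v ∘ (Equiv.ofBijective e he).symm) ⬝ᵥ (S *ᵥ (v ∘ (Equiv.ofBijective e he).symm)) := by
  rw [submatrix_mulVec_of_bijective he, dotProduct_comp_of_bijective he]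

omit [DecidableEq m] [DecidableEq n] in
/-- `|v|² = |v∘e⁻¹|²` under a bijection. [folklore] -/
theorem dotProduct_self_comp_symm {e : m → n} (he : Function.Bijective e) (v : m → ℝ) :
    (v ∘ (Equiv.ofBijective e he).symm) ⬝ᵥ (v ∘ (Equiv.ofBijective e he).symm) = v ⬝ᵥ v := by
  have h := dotProduct_comp_of_bijective he v (v ∘ (Equiv.ofBijective e he).symm)
  rw [← h]
  congr 1
  funext a
  simp only [Function.comp_apply, Equiv.ofBijective_symm_apply_apply]

omit [DecidableEq m] [DecidableEq n] in
/-- **`coercive_submatrix`** — coercivity is invariant under a bijective re-indexing: `γ|u|² ≤ ⟨u,Su⟩ ∀u ⟹ γ|v|² ≤ ⟨v,(S∘(e,e))v⟩ ∀v`. [folklore] -/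
theorem coercive_submatrix {e : m → n} (he : Function.Bijective e) {S : Matrix n n ℝ} {γ : ℝ} (hS : QGQInverse.Coercive S γ) :
    QGQInverse.Coercive (S.submatrix e e) γ := by
  intro v
  rw [form_submatrix_eq he, ← dotProduct_self_comp_symm he v]
  exact hS _

omit [DecidableEq m] [DecidableEq n] in
/-- **`form_le_submatrix`** — an upper form bound is invariant under a bijective re-indexing. [folklore] -/
theorem form_le_submatrix {e : m → n} (he : Function.Bijective e) {S : Matrix n n ℝ} {Λ : ℝ} (hS : ∀ u : n → ℝ, u ⬝ᵥ (S *ᵥ u) ≤ Λ * (u ⬝ᵥ u)) (v : m → ℝ) :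
    v ⬝ᵥ (S.submatrix e e *ᵥ v) ≤ Λ * (v ⬝ᵥ v) := by
  rw [form_submatrix_eq he, ← dotProduct_self_comp_symm he v]
  exact hS _

omit [DecidableEq m] [DecidableEq n] in
/-- a nonnegative form stays nonnegative under a bijective re-indexing. [folklore] -/
theorem form_nonneg_submatrix {e : m → n} (he : Function.Bijective e) {S : Matrix n n ℝ} (hS : ∀ u : n → ℝ, 0 ≤ u ⬝ᵥ (S *ᵥ u)) (v : m → ℝ) :
    0 ≤ v ⬝ᵥ (S.submatrix e e *ᵥ v) := by
  rw [form_submatrix_eq he]; exact hS _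

omit [Fintype m] [Fintype n] [DecidableEq m] [DecidableEq n] in
/-- symmetry is invariant under re-indexing: `(S∘(e,e))ᵀ = S∘(e,e)` for `Sᵀ = S`. [folklore] -/
theorem transpose_submatrix_eq {α : Type*} (e : m → n) {S : Matrix n n α} (hS : Sᵀ = S) : (S.submatrix e e)ᵀ = S.submatrix e e := by
  rw [Matrix.transpose_submatrix, hS]

omit [DecidableEq m] in
/-- **`inv_submatrix_of_bijective`** — `(S∘(e,e))⁻¹ = S⁻¹∘(e,e)` for a bijection `e` (Mathlib's `inv_submatrix_equiv` at `Equiv.ofBijective`). [folklore] -/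
theorem inv_submatrix_of_bijective {α : Type*} [CommRing α] [DecidableEq m] {e : m → n} (he : Function.Bijective e) (S : Matrix n n α) :
    (S.submatrix e e)⁻¹ = S⁻¹.submatrix e e :=
  Matrix.inv_submatrix_equiv S (Equiv.ofBijective e he) (Equiv.ofBijective e he)

omit [DecidableEq m] [DecidableEq n] in
/-- products re-index along a bijective middle map: `(X·Y)∘(e₁,e₃) = (X∘(e₁,e))·(Y∘(e,e₃))` (Mathlib's `submatrix_mul`). [folklore] -/
theorem submatrix_mul_of_bijective {α : Type*} [CommRing α] {l p q : Type*} [Fintype l] {e : m → n} (he : Function.Bijective e)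
    (X : Matrix p n α) (Y : Matrix n q α) (e₁ : l → p) (e₃ : l → q) :
    (X * Y).submatrix e₁ e₃ = X.submatrix e₁ e * Y.submatrix e e₃ :=
  Matrix.submatrix_mul X Y e₁ e e₃ he

end Reindex

/-! ## §5 The torus sup-distance against the window norm, at a pair -/

section Window

/-- **`exp_neg_tdist_le_exp_window`** — a decay in the torus sup-distance `tdist(y,y′)` on `(ℤ∕s)^d` is a window decay at rate `m∕d`: `e^{−m·tdist(y,y′)} ≤ e^{−(m∕d)·|windowMap(y − y′)|₁}`
(`m ≥ 0`, `d ≥ 1`; PART 134's `l1_windowMap_le` and PART 142's `tdist_eq_tdist_sub_zero`). [folklore] -/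
theorem exp_neg_tdist_le_exp_window (hd : 1 ≤ d) (s : ℕ) [NeZero s] {m : ℝ} (hm : 0 ≤ m) (y y' : Site d s) :
    Real.exp (-(m * (tdist (N := cubic d s) y y' : ℝ))) ≤ Real.exp (-(m / d) * l1 (windowMap d s (y - y'))) := by
  have hd0 : (0 : ℝ) < d := by exact_mod_cast lt_of_lt_of_le zero_lt_one hd
  have h1 := l1_windowMap_le s (y - y')
  have h2 : (tdist (N := cubic d s) y y' : ℝ) = (tdist (N := fun _ : Fin d => s) (y - y') 0 : ℝ) := by
    rw [tdist_eq_tdist_sub_zero]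
  apply Real.exp_le_exp.mpr
  rw [h2]
  have h3 : m / d * l1 (windowMap d s (y - y')) ≤ m * (tdist (N := fun _ : Fin d => s) (y - y') 0 : ℝ) := by
    calc m / d * l1 (windowMap d s (y - y')) ≤ m / d * (d * (tdist (N := fun _ : Fin d => s) (y - y') 0 : ℝ)) :=
          mul_le_mul_of_nonneg_left h1 (div_nonneg hm hd0.le)
      _ = m * (tdist (N := fun _ : Fin d => s) (y - y') 0 : ℝ) := by field_simp
  linarith

/-- the same with the difference written `y′ − y`. [folklore] -/
theorem exp_neg_tdist_le_exp_window' (hd : 1 ≤ d) (s : ℕ) [NeZero s] {m : ℝ} (hm : 0 ≤ m) (y y' : Site d s) :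
    Real.exp (-(m * (tdist (N := cubic d s) y y' : ℝ))) ≤ Real.exp (-(m / d) * l1 (windowMap d s (y' - y))) := by
  rw [← neg_sub y y', l1_windowMap_neg]
  exact exp_neg_tdist_le_exp_window hd s hm y y'

end Window

end Summit.QuantumFields.BalabanUV.Beta.GAN24.VolumeLimitPairsRect

end
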